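import Summits.BirchSwinnertonDyer.BirchSwinnertonDyer.Theorems.ByReductionTypeAtTwoOrdKatoHalfAtTwoIsoConjATwoOfTotallyComplexMuRat
import Literature.NumberTheory.IwasawaTheory.ClassicalMuVanishesQuadraticAscentSqrt
import Literature.NumberTheory.EllipticCurves.ZpExtensionRestrictCyclotomic
import Literature.NumberTheory.IwasawaTheory.ClassicalMuVanishesNormRelationTower
import HarnessLib

/-!
# Statement (A) at `2` for `E/ℚ` with `Δ_E < 0` from Iwasawa's `μ₂ = 0` of a subfield `K ⊂ ℚ(E[2]) = K(√m)` with at most one real embedding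
# (the cubic point field `ℚ(P)`) — crux `OrdKatoHalfAtTwoIso` (stmt-BirchSwinnertonDyer-19573), K4 cone, cell bsd-2adic

Written by the prover seat `cruxlead-stmt-BirchSwinnertonDyer-19573-w2` GEN 7 (`--supports` stmt-BirchSwinnertonDyer-19573; no item closed; BSD is NOT
proved here). Final assembly (E-c) of the seat's «Iwasawa ℓ = 2 ascent with real places»:

* `classicalMu_divisionField_two_of_sq_eq_of_Δ_neg` — `E/ℚ` elliptic with `Δ_E < 0`; `K` a number field with at most one real embedding, mapped into
  `ℚ(E[2])` with `[ℚ(E[2]) : K] = 2` and `ℚ(E[2]) = K(x)`, `x² = m ∈ 𝓞_K ∖ 0`; `κ` the cyclotomic `ℤ₂`-extension of `ℚ` with `κ ∘ res` onto for `K`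
  and `ℚ(E[2])`: `μ₂ = 0` for the cyclotomic `ℤ₂`-extension of `K` ⟹ `μ₂ = 0` for every cyclotomic `ℤ₂`-extension of `ℚ(E[2])`
  (`ℚ(E[2])` is totally complex as `Δ_E < 0`; Literature `classicalMuVanishes_restrict_rat_of_sq_eq`).
* **`conjA_two_of_classicalMu_of_sq_eq_of_Δ_neg`** — under the same hypotheses, statement (A) at `2` in the K4 cone's kernel form
  (`∃ γ D, Module.Finite ℤ_[2] D.X` for every cyclotomic `κ`), through `conjA_two_of_classicalMu_divisionField_two_of_Δ_neg`.

Use: `K = ℚ(P)` (`P ∈ E[2] ∖ 0`, cubic, one real place when `Δ_E < 0`), `x = √Δ_E`-type generator: the cell's cubic `μ₂`-certificates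
(`classicalMuVanishes_two_adjoin_of_*`) become kernel statement (A) at `2` on `Δ_E < 0`.

References: [Iwasawa1973MuInvariants] Thm. 2/3; [Washington1997] §13; [CoatesSujatha2005] §3; [Silverman2009AEC] VIII §1.
-/

set_option autoImplicit false

noncomputable section

open scoped NumberField
open NumberField

namespace Summit.BirchSwinnertonDyer.BirchSwinnertonDyer.Theorems.SteinbergFibreAtTwo.TotallyComplexMu

open Literature.NumberTheory.EllipticCurves Literature.NumberTheory.EllipticCurves.ZpExtension
  Literature.NumberTheory.GaloisRepresentations Literature.NumberTheory.IwasawaTheory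

variable (W : WeierstrassCurve ℚ) [W.IsElliptic]

/-- **`μ₂ = 0` ascends from `K` to `ℚ(E[2]) = K(√m)` when `Δ_E < 0`**: `E/ℚ` elliptic, `Δ_E < 0` (so `ℚ(E[2])` is totally complex); `K` a number
field with at most one real embedding, `[ℚ(E[2]) : K] = 2` (`ℚ(E[2])` a number field — the `NumberField` instance binder is discharged by
`NumberField.mk`), `ℚ(E[2]) = K(x)` with `x ∈ 𝓞`, `x² = m ∈ 𝓞_K`, `m ≠ 0`; `κ` cyclotomic over `ℚ` with
`κ ∘ res` onto for `K` and for `ℚ(E[2])`; `μ₂ = 0` for the cyclotomic `ℤ₂`-extensions of `K` ⟹ `μ₂ = 0` for every cyclotomic `ℤ₂`-extension of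
`ℚ(E[2])`. [cite: Iwasawa1973MuInvariants, Thm. 2 and Thm. 3] [cite: Washington1997, §13.3 Prop. 13.23] -/
theorem classicalMu_divisionField_two_of_sq_eq_of_Δ_neg (hΔ : W.Δ < 0)
    [NumberField ↥(W.divisionField 2)]
    (K : Type) [Field K] [NumberField K] [Algebra K ↥(W.divisionField 2)] [Subsingleton (K →+* ℝ)]
    (hdeg : Module.finrank K ↥(W.divisionField 2) = 2)
    {x : 𝓞 ↥(W.divisionField 2)} {m : 𝓞 K} (hm : m ≠ 0)
    (hx : x ^ 2 = algebraMap (𝓞 K) (𝓞 ↥(W.divisionField 2)) m)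
    (hgen : Algebra.adjoin K {(x : ↥(W.divisionField 2))} = ⊤)
    (κ : ZpExtension ℚ 2) (hκ : κ.IsCyclotomic)
    (hK : Function.Surjective (κ.toContinuousMonoidHom.comp (absGaloisRestrict ℚ K)))
    (hK' : Function.Surjective (κ.toContinuousMonoidHom.comp (absGaloisRestrict ℚ ↥(W.divisionField 2))))
    (hμ : ∀ κP : ZpExtension K 2, κP.IsCyclotomic → ClassicalMuVanishes κP) :
    ∀ κF : ZpExtension ↥(W.divisionField 2) 2, κF.IsCyclotomic → ClassicalMuVanishes κF := by
  intro κF hκF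
  haveI : Fact (Nat.Prime 2) := ⟨Nat.prime_two⟩
  haveI : IsTotallyComplex ↥(W.divisionField 2) := ⟨isComplex_infinitePlace_divisionField_two_of_Δ_neg W hΔ⟩
  have h1 : ClassicalMuVanishes (κ.restrict K hK) := hμ _ (isCyclotomic_restrict κ hκ K hK)
  have h2 : ClassicalMuVanishes (κ.restrict ↥(W.divisionField 2) hK') :=
    classicalMuVanishes_restrict_rat_of_sq_eq κ hκ K ↥(W.divisionField 2) hdeg hm hx hgen hK hK' h1
  exact (classicalMuVanishes_iff_of_isCyclotomic _ _ (isCyclotomic_restrict κ hκ _ hK') hκF).mp h2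

/-- **Statement (A) at `2` for `E/ℚ` with `Δ_E < 0` from `μ₂ = 0` of a subfield `K ⊂ ℚ(E[2]) = K(√m)` with at most one real embedding**
(intended `K = ℚ(P)`, the cubic field of a `2`-torsion point): hypotheses as in `classicalMu_divisionField_two_of_sq_eq_of_Δ_neg`; conclusion the
K4 cone's kernel form of (A) at `2` — for the cyclotomic `κ`, some `FineSelmerDualData` has `X` finitely generated over `ℤ₂`
(through `conjA_two_of_classicalMu_divisionField_two_of_Δ_neg`). BSD is not proved here. [cite: CoatesSujatha2005, §3 Thm. 3.4 and Cor. 3.6]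
[cite: Iwasawa1973MuInvariants, Thm. 2 and Thm. 3] -/
theorem conjA_two_of_classicalMu_of_sq_eq_of_Δ_neg (hΔ : W.Δ < 0)
    [NumberField ↥(W.divisionField 2)]
    (K : Type) [Field K] [NumberField K] [Algebra K ↥(W.divisionField 2)] [Subsingleton (K →+* ℝ)]
    (hdeg : Module.finrank K ↥(W.divisionField 2) = 2)
    {x : 𝓞 ↥(W.divisionField 2)} {m : 𝓞 K} (hm : m ≠ 0)
    (hx : x ^ 2 = algebraMap (𝓞 K) (𝓞 ↥(W.divisionField 2)) m)
    (hgen : Algebra.adjoin K {(x : ↥(W.divisionField 2))} = ⊤)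
    (κ : ZpExtension ℚ 2) (hκ : κ.IsCyclotomic)
    (hK : Function.Surjective (κ.toContinuousMonoidHom.comp (absGaloisRestrict ℚ K)))
    (hK' : Function.Surjective (κ.toContinuousMonoidHom.comp (absGaloisRestrict ℚ ↥(W.divisionField 2))))
    (hμ : ∀ κP : ZpExtension K 2, κP.IsCyclotomic → ClassicalMuVanishes κP) :
    ∃ (γ : Field.absoluteGaloisGroup ℚ) (D : W.FineSelmerDualData κ γ),
      Module.Finite ℤ_[2] (RestrictScalars ℤ_[2] (IwasawaAlgebra 2) D.X) :=
  conjA_two_of_classicalMu_divisionField_two_of_Δ_neg W hΔ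
    (classicalMu_divisionField_two_of_sq_eq_of_Δ_neg W hΔ K hdeg hm hx hgen κ hκ hK hK' hμ) κ hκ

end Summit.BirchSwinnertonDyer.BirchSwinnertonDyer.Theorems.SteinbergFibreAtTwo.TotallyComplexMu

end
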